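import Literature.MathematicalPhysics.QuantumFieldTheory.Balaban1983to89.B6Lemma24Printed
import Literature.MathematicalPhysics.QuantumFieldTheory.Balaban1983to89.B6Lemma24Assembly

/-!
# `Balaban1983to89.B6Form2122LowerBound` — T. Bałaban, *Propagators and renormalization transformations for lattice
# gauge theories. II*, Commun. Math. Phys. **96** (1984) 223–250 [Balaban1984PropagatorsII], Sect. C p. 244 / p. 246:
# the form (2.122) `‖B↾_{Λ^c}‖² + L^{−2}‖(Q₁B)↾_{Λ′}‖² + γ₀‖∂₁B‖²` is bounded from below by `γ″₀‖B‖²` on the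
# configurations in the tree gauge (2.121) — PROVED on the concrete ℤ^d carrier of Lemma 2.4, with an explicit `γ″₀(d, L, γ₀)`

statement-level skeleton of published theorems with citation tags; proofs where landed; nothing here is a claim about the Yang–Mills mass gap

PDF held: `paper:balaban1984-cmp96-propagators-rt-ii` (journal page = PDF page + 222); pp. 244–246 [PDF 22–24] read AS
IMAGES on the ×2 renders `run/shared/lean/pub/pub-balaban/b2b-balaban-ref1/pages/1984-cmp96-propagators-rt-II/…-p022-x2.png`,
`…-p024-x2.png`.

CITATION HEADER (lean-in-tree rule).  WHAT IS REPRODUCED: lit-balaban SKELETON rows **B6.Txt@246** (its first half: *"These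
forms are bounded from below by γ″₀‖B‖² with a positive constant γ″₀ dependent on d and L only"* — until now the use-site
hypothesis (S3) of `…B6FromB4` / `…DagDischarged`, `typed-existing`) and **B6.Eq2.120** ((2.120)–(2.122): the form (2.122)
gets a body here, `form2122`, and the sentence *"bounded from below by ‖B↾_{Λ^c}‖²"* is `normSqOut_le_form2122`).  Unit
`lit-balaban-r03` (B6 reader/typer and fold owner, gen 4), PHASE 2 (G.1/G.2(b): typed-not-proved rows of the seat's own
block), HOME `run/shared/lean/pub/lit-balaban/`, 2026-08-21.  IMPORTS `…B6Lemma24Printed` (Lemma 2.4 WITH THE PRINTED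
CONSTANT on the concrete carrier: `lemma24_one`) and `…B6Lemma24Assembly` (`mem_coarseBonds`, `dvd_of_mem_coarseBonds`);
through them the carrier vocabulary of `…B6Lemma24Carrier` / `…B6TreeGaugePoincare` / `…B6Elimination` /
`…B6BondElimination` (`Cfg`, `curl`, `block`, `lam`, `lamBonds`, `lamPlaq`, `coarseBonds`, `q1Term`, `q1Of`, `normSq`,
`d1Sq`, `treeBonds`, `unitVec`) — all consumed BY NAME, nothing restated.

PRINT (verbatim).  p. 244 [PDF 22]: *"(we take a = 1) ‖B↾_{Λ^c}‖² + L^{−2}‖(Q₁B)↾_{Λ′}‖² + ⟨B, Δ_jB⟩ (2.120) on the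
configurations B satisfying B(b) = 0 for b ⊂ Γ_{y,x}, x ∈ B(y), y ∈ Λ′. (2.121) The form is bounded from above, and
bounded from below by ‖B↾_{Λ^c}‖². There is also the bound (2.118), so let us consider the form
‖B↾_{Λ^c}‖² + L^{−2}‖(Q₁B)↾_{Λ′}‖² + γ₀‖∂₁B‖². (2.122) We will prove that it is bounded from below by γ″₀‖B‖² on the
configurations B satisfying (2.121)."*  p. 246 [PDF 24], after Lemma 2.4: *"Another consequence is a bound from below for the
form (2.120), or for the form (2.122). These forms are bounded from below by γ″₀‖B‖² with a positive constant γ″₀ dependent on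
d and L only."*  Lemma 2.4 (2.128) p. 245 (quoted in `…B6Lemma24Carrier`): *"L^{d−2} Σ_{c∈Λ′} |(Q₁B)(c)|² + Σ_p |(∂₁B)(p)|²
≥ (1/(12d²)) L^{−d−1} ‖B‖²"* for B on the bonds of Λ = B(Λ′) in the gauge (2.121), B = 0 outside Λ.

DICTIONARY (the concrete carrier of `…B6Lemma24Carrier`, ambient ℤ^d; the torus `T_□` of (2.89) enters only through a
finite bond set `Ω` carrying `B`).  A configuration is `B : Cfg d` = a real function on the unit bonds `(z, μ) ↔ ⟨z, z + e_μ⟩`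
of ℤ^d, vanishing off the finite set `Ω` (`hΩ`); `Λ′ ⊂ Lℤ^d` finite, `Λ = lam L Λ′ = ⋃_{y∈Λ′} B(y)`; the bonds of Λ =
`lamBonds L Λ′` (at least one end point in Λ — the Lemma's own convention), assumed `⊆ Ω`.  The three terms of (2.122):
`‖B↾_{Λ^c}‖²` := `normSqOut` = Σ over the bonds of `Ω` that are NOT bonds of Λ (both end points outside Λ; with the other
reading — at least one end point in Λ^c — the term is larger and the theorem holds a fortiori);
`L^{−2}‖(Q₁B)↾_{Λ′}‖²` := `L^{d−2} · q1Of L Λ′ B` (the L-lattice norm carries the weight `L^d`, so `L^{−2}·L^d Σ_c |(Q₁B)(c)|²`;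
`|(Q₁B)(c)|²` = the printed (2.125) expression `q1Term`, summed over the coarse bonds `c` meeting `Λ′` exactly as in (2.128));
`‖∂₁B‖²` := `d1SqOn P B` = Σ_{p∈P} |(∂₁B)(p)|² over ANY finite plaquette set `P ⊇ lamPlaq L Λ′` (e.g. all plaquettes meeting
`Ω`; only the plaquettes near Λ are used); `‖B‖²` := `normSqOn Ω B` = Σ_{b∈Ω} |B(b)|²; (2.121) = `B = 0` on the tree bonds
`treeBonds L y` of every block `B(y)`, `y ∈ Λ′` (`…B6BondElimination`, = the printed axial gauge by
`…B6AxialGaugeDictionary`).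

WHAT IS PROVED (0 sorry, 0 new named facts).  `form2122` (def with body) and `gammaPP d L γ₀ = c/(c + 4 + 32d² + 2/γ₀)`,
`c = L^{−(d+1)}/(12d²)` (def); `normSqOut_le_form2122` (p. 244 *"bounded from below by ‖B↾_{Λ^c}‖²"*); the pieces
`lemma24_restrict` (Lemma 2.4 AS PRINTED applied to `B·1_{bonds(Λ)}`), `q1Of_restrict_le` + `q1Of_out_le` (the `Q₁`-term of
the truncated configuration against that of `B` and `L^{−d}‖B↾_{Λ^c}‖²`: Cauchy–Schwarz along the straight contours, each
unit bond lying on the contours of at most one coarse bond per direction and shift), `d1Sq_restrict_le` (the plaquette term of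
the truncated configuration against `2Σ_p|(∂₁B)(p)|² + 32d²‖B↾_{Λ^c}‖²`), and the printed claim **`form2122_lower`**:
`γ″₀ ‖B‖² ≤ ‖B↾_{Λ^c}‖² + L^{−2}‖(Q₁B)↾_{Λ′}‖² + γ₀‖∂₁B‖²` for every `d ≥ 2`, `L ≥ 1`, `γ₀ > 0`, every finite `Λ′ ⊂ Lℤ^d`,
every finite `Ω ⊇ bonds(Λ)`, `P ⊇ lamPlaq L Λ′`, and every `B` vanishing off `Ω` in the gauge (2.121), with
`γ″₀ = gammaPP d L γ₀ > 0` (`gammaPP_pos`) depending on `d`, `L` (and `γ₀ = γ₀(d)` of (2.118)) only — NOT on `Λ′`, `Ω`, `B`.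
v1.1 (§5, append-only, same seat): **`form2122_upper`** — p. 244 *"The form is bounded from above"*: `form2122 ≤
(1 + L^{−2} + 16d²γ₀)‖B‖²_Ω` for every `B` vanishing off `Ω` and every plaquette set inside a box (no gauge condition).
NOT HERE: the identification of `q1Term` with B5's operator `Q₁` (see
`…B6Lemma24Carrier` HONEST SCOPE), the torus (the statement is on ℤ^d with a finite support `Ω`), and the consequence for the
covariance `C̃^{(j)}_Λ` (second half of row B6.Txt@246: `…B6Repr2129.norm_cov_le`, p22).
-/

open Finset

namespace Literature.MathematicalPhysics.QuantumFieldTheory.Balaban1983to89.B6Form2122LowerBound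

open B6Elimination (block mem_block card_block)
open B6BondElimination (unitVec unitVec_apply add_smul_unitVec_apply treeBonds mem_treeBonds)
open B6TreeGaugePoincare (Cfg curl)
open B6Lemma24Carrier (lam mem_lam lamBonds mem_lamBonds lamPlaqBase lamPlaq mem_lamPlaq eq_of_mem_block normSq d1Sq
  coarseBonds q1Term q1Of q1Of_nonneg)
open B6Lemma24Assembly (mem_coarseBonds dvd_of_mem_coarseBonds)
open B6Lemma24Printed (lemma24_one)

noncomputable section

variable {d : ℕ} {L : ℕ}

/-! ## §1  The form (2.122) on the concrete carrier -/

/-- `B·1_{bonds(Λ)}`: the configuration truncated to the bonds of Λ (*"We put B = 0 outside Λ"*, Lemma 2.4 p. 245) — the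
configuration to which Lemma 2.4 is applied. [cite: Balaban1984PropagatorsII, Lemma 2.4 p.245] -/
def restrictLam (L : ℕ) (Λ' : Finset (Fin d → ℤ)) (B : Cfg d) : Cfg d :=
  fun b => if b ∈ lamBonds L Λ' then B b else 0

/-- `B·1_{Λ^c}`: the configuration on the bonds with both end points outside Λ. [cite: Balaban1984PropagatorsII, (2.122) p.244] -/
def restrictOut (L : ℕ) (Λ' : Finset (Fin d → ℤ)) (B : Cfg d) : Cfg d :=
  fun b => if b ∈ lamBonds L Λ' then 0 else B b

/-- `‖B‖²` over the finite bond set `Ω` carrying the configuration. [cite: Balaban1984PropagatorsII, (2.122) p.244] -/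
def normSqOn (Ω : Finset ((Fin d → ℤ) × Fin d)) (B : Cfg d) : ℝ := ∑ b ∈ Ω, B b ^ 2

/-- `‖B↾_{Λ^c}‖²`: the bonds of `Ω` that are not bonds of Λ. [cite: Balaban1984PropagatorsII, (2.122) p.244] -/
def normSqOut (L : ℕ) (Λ' : Finset (Fin d → ℤ)) (Ω : Finset ((Fin d → ℤ) × Fin d)) (B : Cfg d) : ℝ :=
  ∑ b ∈ Ω \ lamBonds L Λ', B b ^ 2

/-- `‖∂₁B‖²` over a finite plaquette set `P` (plaquettes encoded `(z, j, μ)` as in `…B6Lemma24Carrier`).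
[cite: Balaban1984PropagatorsII, (2.122) p.244] -/
def d1SqOn (P : Finset ((Fin d → ℤ) × Fin d × Fin d)) (B : Cfg d) : ℝ := ∑ p ∈ P, curl B p.1 p.2.1 p.2.2 ^ 2

/-- **The form (2.122)** `‖B↾_{Λ^c}‖² + L^{−2}‖(Q₁B)↾_{Λ′}‖² + γ₀‖∂₁B‖²` (with `L^{−2}‖(Q₁B)↾_{Λ′}‖² = L^{d−2}Σ_c|(Q₁B)(c)|²`,
the L-lattice norm carrying the weight `L^d`). [cite: Balaban1984PropagatorsII, (2.122) p.244] -/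
def form2122 (L : ℕ) (Λ' : Finset (Fin d → ℤ)) (Ω : Finset ((Fin d → ℤ) × Fin d))
    (P : Finset ((Fin d → ℤ) × Fin d × Fin d)) (γ₀ : ℝ) (B : Cfg d) : ℝ :=
  normSqOut L Λ' Ω B + (L : ℝ) ^ ((d : ℝ) - 2) * q1Of L Λ' B + γ₀ * d1SqOn P B

/-- The constant of Lemma 2.4 (2.128): `c = (1/(12d²)) L^{−(d+1)}`. [cite: Balaban1984PropagatorsII, Lemma 2.4 (2.128) p.245] -/
def c24 (d L : ℕ) : ℝ := 1 / (12 * (d : ℝ) ^ 2) * (L : ℝ) ^ (-((d : ℝ) + 1))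

/-- **`γ″₀`** (*"a positive constant γ″₀ dependent on d and L only"* — and on the `γ₀ = γ₀(d)` of (2.118)):
`γ″₀ = c/(c + 4 + 32d² + 2/γ₀)`, `c = L^{−(d+1)}/(12d²)`. [cite: Balaban1984PropagatorsII, p.244, p.246] -/
def gammaPP (d L : ℕ) (γ₀ : ℝ) : ℝ := c24 d L / (c24 d L + (4 + 32 * (d : ℝ) ^ 2 + 2 / γ₀))

/-- `c > 0` (the constant of (2.128)). [cite: Balaban1984PropagatorsII, Lemma 2.4 (2.128) p.245] -/
theorem c24_pos (hd : 1 ≤ d) (hL : 1 ≤ L) : 0 < c24 d L := by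
  unfold c24
  have hd' : (0 : ℝ) < d := by exact_mod_cast hd
  have hL' : (0 : ℝ) < L := by exact_mod_cast hL
  positivity

/-- `γ″₀ > 0`. [cite: Balaban1984PropagatorsII, p.246] -/
theorem gammaPP_pos (hd : 1 ≤ d) (hL : 1 ≤ L) {γ₀ : ℝ} (hγ : 0 < γ₀) : 0 < gammaPP d L γ₀ := by
  unfold gammaPP
  have hc := c24_pos hd hL
  have hd' : (0 : ℝ) ≤ d := by positivity
  positivity

/-- p. 244: *"The form is … bounded from below by ‖B↾_{Λ^c}‖²"* (the other two terms are non-negative).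
[cite: Balaban1984PropagatorsII, (2.120)–(2.122) p.244] -/
theorem normSqOut_le_form2122 (Λ' : Finset (Fin d → ℤ)) (Ω : Finset ((Fin d → ℤ) × Fin d))
    (P : Finset ((Fin d → ℤ) × Fin d × Fin d)) {γ₀ : ℝ} (hγ : 0 ≤ γ₀) (B : Cfg d) :
    normSqOut L Λ' Ω B ≤ form2122 L Λ' Ω P γ₀ B := by
  unfold form2122
  have h1 : 0 ≤ (L : ℝ) ^ ((d : ℝ) - 2) * q1Of L Λ' B :=
    mul_nonneg (Real.rpow_nonneg (Nat.cast_nonneg L) _) (q1Of_nonneg Λ' B)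
  have h2 : 0 ≤ γ₀ * d1SqOn P B := mul_nonneg hγ (sum_nonneg fun _ _ => sq_nonneg _)
  linarith

/-! ## §2  Generic finite-sum bookkeeping -/

/-- A sum of a non-negative function vanishing off `D` over any finite set is at most its sum over `D`. [folklore] -/
private theorem sum_le_sum_of_vanish {α : Type*} [DecidableEq α] (T D : Finset α) (g : α → ℝ) (hg : ∀ a, 0 ≤ g a)
    (hD : ∀ a, a ∉ D → g a = 0) : ∑ a ∈ T, g a ≤ ∑ a ∈ D, g a := by
  calc ∑ a ∈ T, g a = ∑ a ∈ T.filter (· ∈ D), g a := by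
        rw [Finset.sum_filter_of_ne]
        intro a _ hne
        by_contra h
        exact hne (hD a h)
    _ ≤ ∑ a ∈ D, g a :=
        Finset.sum_le_sum_of_subset_of_nonneg (fun a ha => (Finset.mem_filter.1 ha).2) fun a _ _ => hg a

/-- `(a + b − c − e)² ≤ 4(a² + b² + c² + e²)`. [folklore] -/
private theorem sq_four_le (a b c e : ℝ) : (a + b - c - e) ^ 2 ≤ 4 * (a ^ 2 + b ^ 2 + c ^ 2 + e ^ 2) := by
  nlinarith [sq_nonneg (a - b), sq_nonneg (a + c), sq_nonneg (a + e), sq_nonneg (b + c), sq_nonneg (b + e),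
    sq_nonneg (c - e)]

/-- `(u − v)² ≤ 2u² + 2v²`. [folklore] -/
private theorem sq_sub_le (u v : ℝ) : (u - v) ^ 2 ≤ 2 * u ^ 2 + 2 * v ^ 2 := by
  nlinarith [sq_nonneg (u + v)]

/-! ## §3  The truncated configuration and its squares -/

section Pieces

variable {Λ' : Finset (Fin d → ℤ)} {Ω : Finset ((Fin d → ℤ) × Fin d)} {B : Cfg d}

/-- Pointwise: `B·1_{bonds(Λ)} = B − B·1_{Λ^c}`. [folklore] -/
private theorem restrictLam_eq_sub (L : ℕ) (Λ' : Finset (Fin d → ℤ)) (B : Cfg d) (b : (Fin d → ℤ) × Fin d) :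
    restrictLam L Λ' B b = B b - restrictOut L Λ' B b := by
  unfold restrictLam restrictOut
  split_ifs <;> simp

/-- `(B·1_{Λ^c})²` is non-negative and vanishes off `Ω ∖ bonds(Λ)` when `B` vanishes off `Ω`. [folklore] -/
private theorem restrictOut_sq_vanish (hΩ : ∀ b, b ∉ Ω → B b = 0) (b : (Fin d → ℤ) × Fin d)
    (hb : b ∉ Ω \ lamBonds L Λ') : restrictOut L Λ' B b ^ 2 = 0 := by
  unfold restrictOut
  split_ifs with h
  · simp
  · have : b ∉ Ω := fun hΩ' => hb (Finset.mem_sdiff.2 ⟨hΩ', h⟩)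
    simp [hΩ b this]

/-- `Σ_{Ω∖bonds(Λ)} (B·1_{Λ^c})² = ‖B↾_{Λ^c}‖²`. [folklore] -/
private theorem sum_restrictOut_sq (L : ℕ) (Λ' : Finset (Fin d → ℤ)) (Ω : Finset ((Fin d → ℤ) × Fin d)) (B : Cfg d) :
    ∑ b ∈ Ω \ lamBonds L Λ', restrictOut L Λ' B b ^ 2 = normSqOut L Λ' Ω B := by
  unfold normSqOut restrictOut
  refine Finset.sum_congr rfl fun b hb => ?_
  rw [if_neg (Finset.mem_sdiff.1 hb).2]

/-- Any finite sum of `(B·1_{Λ^c})²` is at most `‖B↾_{Λ^c}‖²`. [folklore] -/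
private theorem sum_restrictOut_sq_le (hΩ : ∀ b, b ∉ Ω → B b = 0) (T : Finset ((Fin d → ℤ) × Fin d)) :
    ∑ b ∈ T, restrictOut L Λ' B b ^ 2 ≤ normSqOut L Λ' Ω B := by
  rw [← sum_restrictOut_sq L Λ' Ω B]
  exact sum_le_sum_of_vanish T _ _ (fun _ => sq_nonneg _) (restrictOut_sq_vanish hΩ)

/-- `‖B·1_{bonds(Λ)}‖²_{bonds(Λ)} = Σ_{bonds(Λ)} B²`. [folklore] -/
private theorem normSq_restrictLam (L : ℕ) (Λ' : Finset (Fin d → ℤ)) (B : Cfg d) :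
    normSq L Λ' (restrictLam L Λ' B) = ∑ b ∈ lamBonds L Λ', B b ^ 2 := by
  unfold normSq restrictLam
  refine Finset.sum_congr rfl fun b hb => ?_
  rw [if_pos hb]

/-- `‖B‖²_Ω = Σ_{bonds(Λ)} B² + ‖B↾_{Λ^c}‖²` when `bonds(Λ) ⊆ Ω`. [folklore] -/
private theorem normSqOn_split (hsub : lamBonds L Λ' ⊆ Ω) (B : Cfg d) :
    normSqOn Ω B = (∑ b ∈ lamBonds L Λ', B b ^ 2) + normSqOut L Λ' Ω B := by
  unfold normSqOn normSqOut
  rw [← Finset.sum_sdiff hsub, add_comm]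

/-! ### Lemma 2.4 applied to the truncated configuration -/

/-- **Lemma 2.4 AS PRINTED, applied to `B·1_{bonds(Λ)}`** (which vanishes outside Λ and inherits the gauge (2.121)):
`c · Σ_{bonds(Λ)} B² ≤ L^{d−2} Σ_c |(Q₁(B·1_Λ))(c)|² + Σ_p |(∂₁(B·1_Λ))(p)|²`.
[cite: Balaban1984PropagatorsII, Lemma 2.4 (2.128) p.245] -/
theorem lemma24_restrict (hd : 2 ≤ d) (hL : 1 ≤ L) (hΛ : ∀ y ∈ Λ', ∀ i, (L : ℤ) ∣ y i)
    (hT : ∀ y ∈ Λ', ∀ b ∈ treeBonds L y, B b = 0) :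
    c24 d L * ∑ b ∈ lamBonds L Λ', B b ^ 2 ≤
      (L : ℝ) ^ ((d : ℝ) - 2) * q1Of L Λ' (restrictLam L Λ' B) + d1Sq L Λ' (restrictLam L Λ' B) := by
  have h := lemma24_one hd hL hΛ (restrictLam L Λ' B)
    (fun b hb => by unfold restrictLam; rw [if_neg hb])
    (fun y hy b hb => by unfold restrictLam; split_ifs <;> simp [hT y hy b hb])
  rw [normSq_restrictLam] at h
  exact h

/-! ### The Q₁-term -/

/-- The linear functional inside (2.125): `ℓ_c(f) = Σ_{x∈B(c₋)} L^{−(d+1)} Σ_{t<L} f(⟨x + te_μ, x + (t+1)e_μ⟩)`, so that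
`|(Q₁f)(c)|² = ℓ_c(f)²` (`q1Term`). [cite: Balaban1984PropagatorsII, (2.125) p.245] -/
def ell (L : ℕ) (c : (Fin d → ℤ) × Fin d) (f : Cfg d) : ℝ :=
  ∑ x ∈ block L c.1, ((L : ℝ)⁻¹) ^ (d + 1) * ∑ t ∈ range L, f (x + (t : ℤ) • unitVec c.2, c.2)

/-- `q1Term L f c = ℓ_c(f)²`. [folklore] -/
private theorem q1Term_eq (L : ℕ) (f : Cfg d) (c : (Fin d → ℤ) × Fin d) : q1Term L f c = ell L c f ^ 2 := rfl

/-- `ℓ_c` is additive: `ℓ_c(f − g) = ℓ_c(f) − ℓ_c(g)`. [folklore] -/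
private theorem ell_sub (L : ℕ) (c : (Fin d → ℤ) × Fin d) (f g : Cfg d) :
    ell L c (fun b => f b - g b) = ell L c f - ell L c g := by
  unfold ell
  rw [← Finset.sum_sub_distrib]
  refine Finset.sum_congr rfl fun x _ => ?_
  rw [← mul_sub, Finset.sum_sub_distrib]

/-- `Σ_c |(Q₁(B·1_Λ))(c)|² ≤ 2Σ_c|(Q₁B)(c)|² + 2Σ_c|(Q₁(B·1_{Λ^c}))(c)|²` — step of our proof of the p. 244 claim, the
`Q₁`-term being the printed (2.125) expression. [cite: Balaban1984PropagatorsII, (2.122) p.244, (2.125) p.245] -/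
theorem q1Of_restrict_le (L : ℕ) (Λ' : Finset (Fin d → ℤ)) (B : Cfg d) :
    q1Of L Λ' (restrictLam L Λ' B) ≤ 2 * q1Of L Λ' B + 2 * q1Of L Λ' (restrictOut L Λ' B) := by
  unfold q1Of
  rw [Finset.mul_sum, Finset.mul_sum, ← Finset.sum_add_distrib]
  refine Finset.sum_le_sum fun c _ => ?_
  have hfun : restrictLam L Λ' B = fun b => B b - restrictOut L Λ' B b := funext (restrictLam_eq_sub L Λ' B)
  rw [q1Term_eq, q1Term_eq, q1Term_eq, hfun, ell_sub]
  exact sq_sub_le _ _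

/-- Cauchy–Schwarz along the straight contours: `ℓ_c(f)² ≤ L^{−(d+1)} Σ_{x∈B(c₋)} Σ_{t<L} f(x + te_μ, μ)²`
(`L^d · L` terms with coefficient `L^{−(d+1)}`). [folklore] -/
private theorem ell_sq_le (hL : 1 ≤ L) (c : (Fin d → ℤ) × Fin d) (f : Cfg d) :
    ell L c f ^ 2 ≤ ((L : ℝ)⁻¹) ^ (d + 1) *
      ∑ x ∈ block L c.1, ∑ t ∈ range L, f (x + (t : ℤ) • unitVec c.2, c.2) ^ 2 := by
  have hL' : (0 : ℝ) < L := by exact_mod_cast hL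
  set a : ℝ := ((L : ℝ)⁻¹) ^ (d + 1) with ha
  have hell : ell L c f = a * ∑ p ∈ block L c.1 ×ˢ range L, f (p.1 + (p.2 : ℤ) • unitVec c.2, c.2) := by
    unfold ell
    rw [Finset.sum_product, Finset.mul_sum]
  have hcard : ((block L c.1 ×ˢ range L).card : ℝ) = (L : ℝ) ^ (d + 1) := by
    rw [Finset.card_product, card_block, Finset.card_range]
    push_cast
    ring
  have hcs := sq_sum_le_card_mul_sum_sq (s := block L c.1 ×ˢ range L)
    (f := fun p => f (p.1 + (p.2 : ℤ) • unitVec c.2, c.2))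
  rw [hcard] at hcs
  rw [hell, mul_pow, Finset.sum_product]
  have ha2 : a ^ 2 * (L : ℝ) ^ (d + 1) = a := by
    rw [ha, sq, mul_assoc, ← mul_pow, inv_mul_cancel₀ hL'.ne', one_pow, mul_one]
  calc a ^ 2 * (∑ x ∈ block L c.1, ∑ t ∈ range L, f (x + (t : ℤ) • unitVec c.2, c.2)) ^ 2
      = a ^ 2 * (∑ p ∈ block L c.1 ×ˢ range L, f (p.1 + (p.2 : ℤ) • unitVec c.2, c.2)) ^ 2 := by
        rw [Finset.sum_product]
    _ ≤ a ^ 2 * ((L : ℝ) ^ (d + 1) *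
          ∑ p ∈ block L c.1 ×ˢ range L, f (p.1 + (p.2 : ℤ) • unitVec c.2, c.2) ^ 2) :=
        mul_le_mul_of_nonneg_left hcs (sq_nonneg _)
    _ = a * ∑ x ∈ block L c.1, ∑ t ∈ range L, f (x + (t : ℤ) • unitVec c.2, c.2) ^ 2 := by
        rw [← mul_assoc, ha2, Finset.sum_product]

/-- For a fixed shift `t`, the map `(c, x) ↦ ⟨x + te_μ, ·⟩` (`c = (y, μ)` a coarse bond meeting `Λ′ ⊂ Lℤ^d`, `x ∈ B(y)`)
is one-to-one: the blocks of the L-lattice are disjoint. [folklore] -/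
private theorem shift_injOn {Λ' : Finset (Fin d → ℤ)} (hL : 1 ≤ L) (hΛ : ∀ y ∈ Λ', ∀ i, (L : ℤ) ∣ y i) (t : ℕ) :
    Set.InjOn (fun p : (Σ _ : (Fin d → ℤ) × Fin d, (Fin d → ℤ)) => (p.2 + (t : ℤ) • unitVec p.1.2, p.1.2))
      ↑((coarseBonds L Λ').sigma fun c => block L c.1) := by
  have hL0 : 0 < L := hL
  intro p hp p' hp' h
  simp only [Finset.mem_coe, Finset.mem_sigma] at hp hp'
  obtain ⟨h1, h2⟩ := Prod.mk.inj h
  have hx : p.2 = p'.2 := by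
    rw [h2] at h1
    exact add_right_cancel h1
  have hy : p.1.1 = p'.1.1 :=
    eq_of_mem_block hL0 (dvd_of_mem_coarseBonds hΛ hp.1) (dvd_of_mem_coarseBonds hΛ hp'.1) hp.2 (hx ▸ hp'.2)
  exact Sigma.ext (Prod.ext hy h2) (heq_of_eq hx)

/-- `Σ_c |(Q₁(B·1_{Λ^c}))(c)|² ≤ L^{−d} ‖B↾_{Λ^c}‖²`: Cauchy–Schwarz per coarse bond, then for each shift `t < L` the unit
bonds `⟨x + te_μ, x + (t+1)e_μ⟩`, `x ∈ B(c₋)`, are distinct for distinct `(c, x)` — step of our proof of the p. 244 claim.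
[cite: Balaban1984PropagatorsII, (2.122) p.244, (2.125) p.245] -/
theorem q1Of_out_le (hL : 1 ≤ L) (hΛ : ∀ y ∈ Λ', ∀ i, (L : ℤ) ∣ y i) (hΩ : ∀ b, b ∉ Ω → B b = 0) :
    q1Of L Λ' (restrictOut L Λ' B) ≤ ((L : ℝ)⁻¹) ^ d * normSqOut L Λ' Ω B := by
  classical
  have hL' : (0 : ℝ) < L := by exact_mod_cast hL
  -- per shift t: the double sum is a sum over an image, bounded by ‖B↾_{Λ^c}‖²
  have hshift : ∀ t : ℕ, ∑ c ∈ coarseBonds L Λ', ∑ x ∈ block L c.1,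
      restrictOut L Λ' B (x + (t : ℤ) • unitVec c.2, c.2) ^ 2 ≤ normSqOut L Λ' Ω B := by
    intro t
    rw [Finset.sum_sigma' (coarseBonds L Λ') (fun c => block L c.1)
      (fun c x => restrictOut L Λ' B (x + (t : ℤ) • unitVec c.2, c.2) ^ 2)]
    calc ∑ p ∈ (coarseBonds L Λ').sigma (fun c => block L c.1),
          restrictOut L Λ' B (p.2 + (t : ℤ) • unitVec p.1.2, p.1.2) ^ 2
        = ∑ b ∈ ((coarseBonds L Λ').sigma (fun c => block L c.1)).image
            (fun p => (p.2 + (t : ℤ) • unitVec p.1.2, p.1.2)), restrictOut L Λ' B b ^ 2 :=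
          (Finset.sum_image (f := fun b => restrictOut L Λ' B b ^ 2) (shift_injOn hL hΛ t)).symm
      _ ≤ ∑ b ∈ Ω \ lamBonds L Λ', restrictOut L Λ' B b ^ 2 :=
          sum_le_sum_of_vanish _ _ (fun b => restrictOut L Λ' B b ^ 2) (fun _ => sq_nonneg _)
            (restrictOut_sq_vanish hΩ)
      _ = normSqOut L Λ' Ω B := sum_restrictOut_sq L Λ' Ω B
  calc q1Of L Λ' (restrictOut L Λ' B)
      = ∑ c ∈ coarseBonds L Λ', ell L c (restrictOut L Λ' B) ^ 2 := by rfl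
    _ ≤ ∑ c ∈ coarseBonds L Λ', ((L : ℝ)⁻¹) ^ (d + 1) *
          ∑ x ∈ block L c.1, ∑ t ∈ range L, restrictOut L Λ' B (x + (t : ℤ) • unitVec c.2, c.2) ^ 2 :=
        Finset.sum_le_sum fun c _ => ell_sq_le hL c _
    _ = ((L : ℝ)⁻¹) ^ (d + 1) * ∑ c ∈ coarseBonds L Λ', ∑ t ∈ range L, ∑ x ∈ block L c.1,
          restrictOut L Λ' B (x + (t : ℤ) • unitVec c.2, c.2) ^ 2 := by
        rw [← Finset.mul_sum]
        exact congrArg _ (Finset.sum_congr rfl fun c _ => Finset.sum_comm)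
    _ = ((L : ℝ)⁻¹) ^ (d + 1) * ∑ t ∈ range L, ∑ c ∈ coarseBonds L Λ', ∑ x ∈ block L c.1,
          restrictOut L Λ' B (x + (t : ℤ) • unitVec c.2, c.2) ^ 2 := by
        rw [Finset.sum_comm]
    _ ≤ ((L : ℝ)⁻¹) ^ (d + 1) * ∑ _t ∈ range L, normSqOut L Λ' Ω B :=
        mul_le_mul_of_nonneg_left (Finset.sum_le_sum fun t _ => hshift t) (by positivity)
    _ = ((L : ℝ)⁻¹) ^ d * normSqOut L Λ' Ω B := by
        rw [Finset.sum_const, Finset.card_range, nsmul_eq_mul, pow_succ]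
        field_simp

/-! ### The plaquette term -/

/-- `curl` is additive: `∂₁(f − g) = ∂₁f − ∂₁g`. [folklore] -/
private theorem curl_sub (f g : Cfg d) (z : Fin d → ℤ) (j μ : Fin d) :
    curl (fun b => f b - g b) z j μ = curl f z j μ - curl g z j μ := by
  unfold curl
  ring

/-- The four bonds of a plaquette: `(∂₁g)(p)² ≤ 4 Σ_{b∈p} g(b)²`. [folklore] -/
private theorem curl_sq_le (g : Cfg d) (z : Fin d → ℤ) (j μ : Fin d) :
    curl g z j μ ^ 2 ≤ 4 * (g (z, j) ^ 2 + g (z + unitVec j, μ) ^ 2 + g (z + unitVec μ, j) ^ 2 + g (z, μ) ^ 2) := by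
  unfold curl
  exact sq_four_le _ _ _ _

/-- Bookkeeping: a plaquette-indexed sum of a bond quantity read at ONE of the four bonds of each plaquette near Λ is at most
`d` times the corresponding bond sum — (i) lowest-corner bonds `(z, j)`. [folklore] -/
private theorem sum_lamPlaq_corner_le (Λ' : Finset (Fin d → ℤ)) (g : (Fin d → ℤ) × Fin d → ℝ) (hg : ∀ b, 0 ≤ g b)
    (D : Finset ((Fin d → ℤ) × Fin d)) (hD : ∀ b, b ∉ D → g b = 0) (sh : Fin d → (Fin d → ℤ))
    (pick : Fin d × Fin d → Fin d) (side : Fin d × Fin d → Fin d) :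
    ∑ p ∈ lamPlaq L Λ', g (p.1 + sh (side p.2), pick p.2) ≤ (d : ℝ) * ((d : ℝ) * ∑ b ∈ D, g b) := by
  classical
  calc ∑ p ∈ lamPlaq L Λ', g (p.1 + sh (side p.2), pick p.2)
      ≤ ∑ p ∈ lamPlaqBase L Λ' ×ˢ ((univ : Finset (Fin d)) ×ˢ (univ : Finset (Fin d))),
          g (p.1 + sh (side p.2), pick p.2) :=
        Finset.sum_le_sum_of_subset_of_nonneg (Finset.filter_subset _ _) fun _ _ _ => hg _
    _ = ∑ jm ∈ (univ : Finset (Fin d)) ×ˢ (univ : Finset (Fin d)),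
          ∑ z ∈ lamPlaqBase L Λ', g (z + sh (side jm), pick jm) := by
        rw [Finset.sum_product, Finset.sum_comm]
    _ ≤ ∑ _jm ∈ (univ : Finset (Fin d)) ×ˢ (univ : Finset (Fin d)), ∑ b ∈ D, g b := by
        refine Finset.sum_le_sum fun jm _ => ?_
        have hinj : Set.InjOn (fun z : Fin d → ℤ => (z + sh (side jm), pick jm)) (lamPlaqBase L Λ') := by
          intro z _ z' _ h
          simpa using (Prod.mk.inj h).1
        rw [← Finset.sum_image (f := g) hinj]
        exact sum_le_sum_of_vanish _ _ g hg hD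
    _ = (d : ℝ) * ((d : ℝ) * ∑ b ∈ D, g b) := by
        rw [Finset.sum_const, Finset.card_product, Finset.card_univ, Fintype.card_fin, nsmul_eq_mul]
        push_cast
        ring

/-- `Σ_{p near Λ} |(∂₁(B·1_{Λ^c}))(p)|² ≤ 16d² ‖B↾_{Λ^c}‖²`. [folklore] -/
private theorem d1Sq_out_le (hΩ : ∀ b, b ∉ Ω → B b = 0) :
    d1Sq L Λ' (restrictOut L Λ' B) ≤ 16 * (d : ℝ) ^ 2 * normSqOut L Λ' Ω B := by
  classical
  have hg0 : ∀ b, 0 ≤ (fun b => restrictOut L Λ' B b ^ 2) b := fun b => sq_nonneg _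
  have hgD := restrictOut_sq_vanish (L := L) (Λ' := Λ') hΩ
  have hS := sum_restrictOut_sq L Λ' Ω B
  -- the four bond readings, each ≤ d·d·‖B↾_{Λ^c}‖²
  have h1 := sum_lamPlaq_corner_le (L := L) Λ' (fun b => restrictOut L Λ' B b ^ 2) hg0 _ hgD
    (fun _ => 0) (fun jm => jm.1) (fun jm => jm.1)
  have h2 := sum_lamPlaq_corner_le (L := L) Λ' (fun b => restrictOut L Λ' B b ^ 2) hg0 _ hgD
    (fun i => unitVec i) (fun jm => jm.2) (fun jm => jm.1)
  have h3 := sum_lamPlaq_corner_le (L := L) Λ' (fun b => restrictOut L Λ' B b ^ 2) hg0 _ hgD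
    (fun i => unitVec i) (fun jm => jm.1) (fun jm => jm.2)
  have h4 := sum_lamPlaq_corner_le (L := L) Λ' (fun b => restrictOut L Λ' B b ^ 2) hg0 _ hgD
    (fun _ => 0) (fun jm => jm.2) (fun jm => jm.2)
  simp only [add_zero] at h1 h2 h3 h4
  rw [hS] at h1 h2 h3 h4
  unfold d1Sq
  calc ∑ p ∈ lamPlaq L Λ', curl (restrictOut L Λ' B) p.1 p.2.1 p.2.2 ^ 2
      ≤ ∑ p ∈ lamPlaq L Λ', 4 * (restrictOut L Λ' B (p.1, p.2.1) ^ 2 +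
          restrictOut L Λ' B (p.1 + unitVec p.2.1, p.2.2) ^ 2 +
          restrictOut L Λ' B (p.1 + unitVec p.2.2, p.2.1) ^ 2 + restrictOut L Λ' B (p.1, p.2.2) ^ 2) :=
        Finset.sum_le_sum fun p _ => curl_sq_le _ _ _ _
    _ = 4 * ((∑ p ∈ lamPlaq L Λ', restrictOut L Λ' B (p.1, p.2.1) ^ 2) +
          (∑ p ∈ lamPlaq L Λ', restrictOut L Λ' B (p.1 + unitVec p.2.1, p.2.2) ^ 2) +
          (∑ p ∈ lamPlaq L Λ', restrictOut L Λ' B (p.1 + unitVec p.2.2, p.2.1) ^ 2) +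
          ∑ p ∈ lamPlaq L Λ', restrictOut L Λ' B (p.1, p.2.2) ^ 2) := by
        rw [← Finset.mul_sum, Finset.sum_add_distrib, Finset.sum_add_distrib, Finset.sum_add_distrib]
    _ ≤ 4 * ((d : ℝ) * ((d : ℝ) * normSqOut L Λ' Ω B) + (d : ℝ) * ((d : ℝ) * normSqOut L Λ' Ω B) +
          (d : ℝ) * ((d : ℝ) * normSqOut L Λ' Ω B) + (d : ℝ) * ((d : ℝ) * normSqOut L Λ' Ω B)) := by
        gcongr
    _ = 16 * (d : ℝ) ^ 2 * normSqOut L Λ' Ω B := by ring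

/-- `Σ_{p near Λ}|(∂₁(B·1_Λ))(p)|² ≤ 2‖∂₁B‖²_P + 32d²‖B↾_{Λ^c}‖²` for any plaquette set `P ⊇ lamPlaq L Λ′` — step of our proof
of the p. 244 claim. [cite: Balaban1984PropagatorsII, (2.122) p.244] -/
theorem d1Sq_restrict_le {P : Finset ((Fin d → ℤ) × Fin d × Fin d)} (hP : lamPlaq L Λ' ⊆ P)
    (hΩ : ∀ b, b ∉ Ω → B b = 0) :
    d1Sq L Λ' (restrictLam L Λ' B) ≤ 2 * d1SqOn P B + 32 * (d : ℝ) ^ 2 * normSqOut L Λ' Ω B := by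
  have hfun : restrictLam L Λ' B = fun b => B b - restrictOut L Λ' B b := funext (restrictLam_eq_sub L Λ' B)
  have hout := d1Sq_out_le (L := L) (Λ' := Λ') hΩ
  have hsub : ∑ p ∈ lamPlaq L Λ', curl B p.1 p.2.1 p.2.2 ^ 2 ≤ d1SqOn P B :=
    Finset.sum_le_sum_of_subset_of_nonneg hP fun _ _ _ => sq_nonneg _
  unfold d1Sq at hout ⊢
  calc ∑ p ∈ lamPlaq L Λ', curl (restrictLam L Λ' B) p.1 p.2.1 p.2.2 ^ 2
      = ∑ p ∈ lamPlaq L Λ', (curl B p.1 p.2.1 p.2.2 - curl (restrictOut L Λ' B) p.1 p.2.1 p.2.2) ^ 2 := by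
        refine Finset.sum_congr rfl fun p _ => ?_
        rw [hfun, curl_sub]
    _ ≤ ∑ p ∈ lamPlaq L Λ', (2 * curl B p.1 p.2.1 p.2.2 ^ 2 + 2 * curl (restrictOut L Λ' B) p.1 p.2.1 p.2.2 ^ 2) :=
        Finset.sum_le_sum fun p _ => sq_sub_le _ _
    _ = 2 * ∑ p ∈ lamPlaq L Λ', curl B p.1 p.2.1 p.2.2 ^ 2 +
          2 * ∑ p ∈ lamPlaq L Λ', curl (restrictOut L Λ' B) p.1 p.2.1 p.2.2 ^ 2 := by
        rw [Finset.sum_add_distrib, Finset.mul_sum, Finset.mul_sum]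
    _ ≤ 2 * d1SqOn P B + 2 * (16 * (d : ℝ) ^ 2 * normSqOut L Λ' Ω B) := by gcongr
    _ = 2 * d1SqOn P B + 32 * (d : ℝ) ^ 2 * normSqOut L Λ' Ω B := by ring

end Pieces

/-! ## §4  The printed claim: `(2.122) ≥ γ″₀‖B‖²` in the gauge (2.121) -/

/-- **p. 244 / p. 246: the form (2.122) is bounded from below by `γ″₀‖B‖²` on the configurations satisfying (2.121)**, with
`γ″₀ = gammaPP d L γ₀` depending on `d`, `L` (and `γ₀ = γ₀(d)`) only.  For every `d ≥ 2`, `L ≥ 1`, `γ₀ > 0`, every finite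
`Λ′ ⊂ Lℤ^d`, every finite bond set `Ω ⊇ bonds(Λ)`, every plaquette set `P ⊇ lamPlaq L Λ′`, and every configuration `B`
vanishing off `Ω` with `B = 0` on the tree bonds of the blocks of `Λ`:
`γ″₀ · ‖B‖²_Ω ≤ ‖B↾_{Λ^c}‖² + L^{−2}‖(Q₁B)↾_{Λ′}‖² + γ₀‖∂₁B‖²_P`.  Proof as in the text: Lemma 2.4 (printed constant) for
`B·1_{bonds(Λ)}`, plus the elementary comparison of its `Q₁`- and `∂₁`-terms with those of `B`.
[cite: Balaban1984PropagatorsII, (2.122) p.244, p.246] -/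
theorem form2122_lower (hd : 2 ≤ d) (hL : 1 ≤ L) {Λ' : Finset (Fin d → ℤ)} (hΛ : ∀ y ∈ Λ', ∀ i, (L : ℤ) ∣ y i)
    {γ₀ : ℝ} (hγ : 0 < γ₀) {Ω : Finset ((Fin d → ℤ) × Fin d)} (hsub : lamBonds L Λ' ⊆ Ω)
    {P : Finset ((Fin d → ℤ) × Fin d × Fin d)} (hP : lamPlaq L Λ' ⊆ P) (B : Cfg d)
    (hΩ : ∀ b, b ∉ Ω → B b = 0) (hT : ∀ y ∈ Λ', ∀ b ∈ treeBonds L y, B b = 0) :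
    gammaPP d L γ₀ * normSqOn Ω B ≤ form2122 L Λ' Ω P γ₀ B := by
  have hd1 : 1 ≤ d := le_trans (by norm_num) hd
  have hL' : (0 : ℝ) < L := by exact_mod_cast hL
  have hL1 : (1 : ℝ) ≤ L := by exact_mod_cast hL
  have hc := c24_pos hd1 hL
  set S := normSqOut L Λ' Ω B with hSdef
  set Qt := (L : ℝ) ^ ((d : ℝ) - 2) * q1Of L Λ' B with hQdef
  set Dt := d1SqOn P B with hDdef
  set N := ∑ b ∈ lamBonds L Λ', B b ^ 2 with hNdef
  have hS0 : 0 ≤ S := sum_nonneg fun _ _ => sq_nonneg _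
  have hQ0 : 0 ≤ Qt := mul_nonneg (Real.rpow_nonneg (Nat.cast_nonneg L) _) (q1Of_nonneg Λ' B)
  have hD0 : 0 ≤ Dt := sum_nonneg fun _ _ => sq_nonneg _
  have hq0 : 0 ≤ q1Of L Λ' B := q1Of_nonneg Λ' B
  have hpow0 : 0 ≤ (L : ℝ) ^ ((d : ℝ) - 2) := Real.rpow_nonneg (Nat.cast_nonneg L) _
  -- Lemma 2.4 on the truncated configuration
  have h24 := lemma24_restrict hd hL hΛ hT
  -- the Q₁-term of the truncated configuration
  have hq := q1Of_restrict_le L Λ' B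
  have hqo := q1Of_out_le (L := L) (Λ' := Λ') hL hΛ hΩ
  -- L^{d−2} · L^{−d} = L^{−2} ≤ 1
  have hLL : (L : ℝ) ^ ((d : ℝ) - 2) * ((L : ℝ)⁻¹) ^ d ≤ 1 := by
    have h1 : ((L : ℝ)⁻¹) ^ d = (L : ℝ) ^ (-(d : ℝ)) := by
      rw [inv_pow, ← Real.rpow_natCast, ← Real.rpow_neg (Nat.cast_nonneg L)]
    rw [h1, ← Real.rpow_add hL']
    have : (d : ℝ) - 2 + -(d : ℝ) = -2 := by ring
    rw [this]
    exact Real.rpow_le_one_of_one_le_of_nonpos hL1 (by norm_num)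
  have hQt : (L : ℝ) ^ ((d : ℝ) - 2) * q1Of L Λ' (restrictLam L Λ' B) ≤ 2 * Qt + 2 * S := by
    calc (L : ℝ) ^ ((d : ℝ) - 2) * q1Of L Λ' (restrictLam L Λ' B)
        ≤ (L : ℝ) ^ ((d : ℝ) - 2) * (2 * q1Of L Λ' B + 2 * (((L : ℝ)⁻¹) ^ d * S)) := by
          refine mul_le_mul_of_nonneg_left (le_trans hq ?_) hpow0
          linarith
      _ = 2 * Qt + 2 * ((L : ℝ) ^ ((d : ℝ) - 2) * ((L : ℝ)⁻¹) ^ d) * S := by rw [hQdef]; ring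
      _ ≤ 2 * Qt + 2 * 1 * S := by gcongr
      _ = 2 * Qt + 2 * S := by ring
  -- the plaquette term of the truncated configuration
  have hDt := d1Sq_restrict_le (L := L) (Λ' := Λ') (B := B) hP hΩ
  -- assemble: c·N ≤ M·F and S ≤ F
  have hd' : (1 : ℝ) ≤ d := by exact_mod_cast hd1
  set M : ℝ := 4 + 32 * (d : ℝ) ^ 2 + 2 / γ₀ with hMdef
  have hF : form2122 L Λ' Ω P γ₀ B = S + Qt + γ₀ * Dt := rfl
  have hcN : c24 d L * N ≤ M * (S + Qt + γ₀ * Dt) := by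
    have h2D : 2 * Dt = 2 / γ₀ * (γ₀ * Dt) := by field_simp
    calc c24 d L * N ≤ (2 * Qt + 2 * S) + (2 * Dt + 32 * (d : ℝ) ^ 2 * S) := le_trans h24 (add_le_add hQt hDt)
      _ = 2 * Qt + 2 / γ₀ * (γ₀ * Dt) + (2 + 32 * (d : ℝ) ^ 2) * S := by rw [h2D]; ring
      _ ≤ M * Qt + M * (γ₀ * Dt) + M * S := by
          have hM2 : (2 : ℝ) ≤ M := by
            rw [hMdef]; have : 0 ≤ 2 / γ₀ := by positivity
            nlinarith
          have hMγ : 2 / γ₀ ≤ M := by rw [hMdef]; nlinarith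
          have hMS : 2 + 32 * (d : ℝ) ^ 2 ≤ M := by
            rw [hMdef]; have : 0 ≤ 2 / γ₀ := by positivity
            linarith
          have hγD : 0 ≤ γ₀ * Dt := mul_nonneg hγ.le hD0
          gcongr
      _ = M * (S + Qt + γ₀ * Dt) := by ring
  have hM0 : 0 < M := by rw [hMdef]; positivity
  have hSF : S ≤ S + Qt + γ₀ * Dt := by nlinarith [mul_nonneg hγ.le hD0]
  -- ‖B‖²_Ω = N + S
  rw [hF, normSqOn_split hsub, ← hNdef, ← hSdef]
  have h3 : c24 d L * S ≤ c24 d L * (S + Qt + γ₀ * Dt) := mul_le_mul_of_nonneg_left hSF hc.le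
  unfold gammaPP
  rw [← hMdef, div_mul_eq_mul_div, div_le_iff₀ (by positivity)]
  calc c24 d L * (N + S) = c24 d L * N + c24 d L * S := by ring
    _ ≤ M * (S + Qt + γ₀ * Dt) + c24 d L * (S + Qt + γ₀ * Dt) := add_le_add hcN h3
    _ = (S + Qt + γ₀ * Dt) * (c24 d L + M) := by ring

/-! ## §5  (v1.1, append-only) p. 244: *"The form is bounded from above"* — an explicit upper bound

The first sentence after (2.121), *"The form is bounded from above, and bounded from below by ‖B↾_{Λ^c}‖²"*: on the
concrete carrier the form (2.122) is at most `(1 + L^{−2} + 16d²γ₀)‖B‖²_Ω` for every configuration vanishing off `Ω`,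
whenever the plaquette set `P` is contained in a box `Z × {directions}` (every finite `P` is) — the `Q₁`-term by the same
Cauchy–Schwarz/injectivity count as `q1Of_out_le`, the plaquette term by the four-bond count of §3. -/

section Upper

variable {Λ' : Finset (Fin d → ℤ)} {Ω : Finset ((Fin d → ℤ) × Fin d)} {B : Cfg d}

/-- `Σ_c |(Q₁f)(c)|² ≤ L^{−d} Σ_D f²` for every configuration `f` vanishing off a finite bond set `D` (Cauchy–Schwarz along
the straight contours; each unit bond lies on the contours of at most one coarse bond per shift). [folklore] -/
private theorem q1Of_le_of_vanish (hL : 1 ≤ L) (hΛ : ∀ y ∈ Λ', ∀ i, (L : ℤ) ∣ y i) (f : Cfg d)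
    (D : Finset ((Fin d → ℤ) × Fin d)) (hD : ∀ b, b ∉ D → f b = 0) :
    q1Of L Λ' f ≤ ((L : ℝ)⁻¹) ^ d * ∑ b ∈ D, f b ^ 2 := by
  classical
  have hL' : (0 : ℝ) < L := by exact_mod_cast hL
  have hD2 : ∀ b, b ∉ D → f b ^ 2 = 0 := fun b hb => by rw [hD b hb]; ring
  have hshift : ∀ t : ℕ, ∑ c ∈ coarseBonds L Λ', ∑ x ∈ block L c.1,
      f (x + (t : ℤ) • unitVec c.2, c.2) ^ 2 ≤ ∑ b ∈ D, f b ^ 2 := by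
    intro t
    rw [Finset.sum_sigma' (coarseBonds L Λ') (fun c => block L c.1)
      (fun c x => f (x + (t : ℤ) • unitVec c.2, c.2) ^ 2)]
    calc ∑ p ∈ (coarseBonds L Λ').sigma (fun c => block L c.1), f (p.2 + (t : ℤ) • unitVec p.1.2, p.1.2) ^ 2
        = ∑ b ∈ ((coarseBonds L Λ').sigma (fun c => block L c.1)).image
            (fun p => (p.2 + (t : ℤ) • unitVec p.1.2, p.1.2)), f b ^ 2 :=
          (Finset.sum_image (f := fun b => f b ^ 2) (shift_injOn hL hΛ t)).symm
      _ ≤ ∑ b ∈ D, f b ^ 2 := sum_le_sum_of_vanish _ _ (fun b => f b ^ 2) (fun _ => sq_nonneg _) hD2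
  calc q1Of L Λ' f
      = ∑ c ∈ coarseBonds L Λ', ell L c f ^ 2 := by rfl
    _ ≤ ∑ c ∈ coarseBonds L Λ', ((L : ℝ)⁻¹) ^ (d + 1) *
          ∑ x ∈ block L c.1, ∑ t ∈ range L, f (x + (t : ℤ) • unitVec c.2, c.2) ^ 2 :=
        Finset.sum_le_sum fun c _ => ell_sq_le hL c _
    _ = ((L : ℝ)⁻¹) ^ (d + 1) * ∑ c ∈ coarseBonds L Λ', ∑ t ∈ range L, ∑ x ∈ block L c.1,
          f (x + (t : ℤ) • unitVec c.2, c.2) ^ 2 := by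
        rw [← Finset.mul_sum]
        exact congrArg _ (Finset.sum_congr rfl fun c _ => Finset.sum_comm)
    _ = ((L : ℝ)⁻¹) ^ (d + 1) * ∑ t ∈ range L, ∑ c ∈ coarseBonds L Λ', ∑ x ∈ block L c.1,
          f (x + (t : ℤ) • unitVec c.2, c.2) ^ 2 := by
        rw [Finset.sum_comm]
    _ ≤ ((L : ℝ)⁻¹) ^ (d + 1) * ∑ _t ∈ range L, ∑ b ∈ D, f b ^ 2 :=
        mul_le_mul_of_nonneg_left (Finset.sum_le_sum fun t _ => hshift t) (by positivity)
    _ = ((L : ℝ)⁻¹) ^ d * ∑ b ∈ D, f b ^ 2 := by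
        rw [Finset.sum_const, Finset.card_range, nsmul_eq_mul, pow_succ]
        field_simp

/-- The four-bond count of §3 over an arbitrary plaquette box `Z × {directions}`: a plaquette-indexed sum of a bond
quantity read at one of the four bonds is at most `d²` times the bond sum. [folklore] -/
private theorem sum_plaqBox_corner_le (Z : Finset (Fin d → ℤ)) (P : Finset ((Fin d → ℤ) × Fin d × Fin d))
    (hPZ : P ⊆ Z ×ˢ ((univ : Finset (Fin d)) ×ˢ (univ : Finset (Fin d))))
    (g : (Fin d → ℤ) × Fin d → ℝ) (hg : ∀ b, 0 ≤ g b)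
    (D : Finset ((Fin d → ℤ) × Fin d)) (hD : ∀ b, b ∉ D → g b = 0) (sh : Fin d → (Fin d → ℤ))
    (pick : Fin d × Fin d → Fin d) (side : Fin d × Fin d → Fin d) :
    ∑ p ∈ P, g (p.1 + sh (side p.2), pick p.2) ≤ (d : ℝ) * ((d : ℝ) * ∑ b ∈ D, g b) := by
  classical
  calc ∑ p ∈ P, g (p.1 + sh (side p.2), pick p.2)
      ≤ ∑ p ∈ Z ×ˢ ((univ : Finset (Fin d)) ×ˢ (univ : Finset (Fin d))), g (p.1 + sh (side p.2), pick p.2) :=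
        Finset.sum_le_sum_of_subset_of_nonneg hPZ fun _ _ _ => hg _
    _ = ∑ jm ∈ (univ : Finset (Fin d)) ×ˢ (univ : Finset (Fin d)), ∑ z ∈ Z, g (z + sh (side jm), pick jm) := by
        rw [Finset.sum_product, Finset.sum_comm]
    _ ≤ ∑ _jm ∈ (univ : Finset (Fin d)) ×ˢ (univ : Finset (Fin d)), ∑ b ∈ D, g b := by
        refine Finset.sum_le_sum fun jm _ => ?_
        have hinj : Set.InjOn (fun z : Fin d → ℤ => (z + sh (side jm), pick jm)) Z := by
          intro z _ z' _ h
          simpa using (Prod.mk.inj h).1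
        rw [← Finset.sum_image (f := g) hinj]
        exact sum_le_sum_of_vanish _ _ g hg hD
    _ = (d : ℝ) * ((d : ℝ) * ∑ b ∈ D, g b) := by
        rw [Finset.sum_const, Finset.card_product, Finset.card_univ, Fintype.card_fin, nsmul_eq_mul]
        push_cast
        ring

/-- `‖∂₁B‖²_P ≤ 16d² ‖B‖²_Ω` for `B` vanishing off `Ω` and `P` inside a box `Z × {directions}`. [folklore] -/
private theorem d1SqOn_le (Z : Finset (Fin d → ℤ)) {P : Finset ((Fin d → ℤ) × Fin d × Fin d)}
    (hPZ : P ⊆ Z ×ˢ ((univ : Finset (Fin d)) ×ˢ (univ : Finset (Fin d)))) (hΩ : ∀ b, b ∉ Ω → B b = 0) :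
    d1SqOn P B ≤ 16 * (d : ℝ) ^ 2 * normSqOn Ω B := by
  classical
  have hg0 : ∀ b, 0 ≤ (fun b => B b ^ 2) b := fun b => sq_nonneg _
  have hgD : ∀ b, b ∉ Ω → (fun b => B b ^ 2) b = 0 := fun b hb => by simp [hΩ b hb]
  have h1 := sum_plaqBox_corner_le Z P hPZ (fun b => B b ^ 2) hg0 _ hgD (fun _ => 0) (fun jm => jm.1) (fun jm => jm.1)
  have h2 := sum_plaqBox_corner_le Z P hPZ (fun b => B b ^ 2) hg0 _ hgD
    (fun i => unitVec i) (fun jm => jm.2) (fun jm => jm.1)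
  have h3 := sum_plaqBox_corner_le Z P hPZ (fun b => B b ^ 2) hg0 _ hgD
    (fun i => unitVec i) (fun jm => jm.1) (fun jm => jm.2)
  have h4 := sum_plaqBox_corner_le Z P hPZ (fun b => B b ^ 2) hg0 _ hgD (fun _ => 0) (fun jm => jm.2) (fun jm => jm.2)
  simp only [add_zero] at h1 h2 h3 h4
  unfold d1SqOn normSqOn
  calc ∑ p ∈ P, curl B p.1 p.2.1 p.2.2 ^ 2
      ≤ ∑ p ∈ P, 4 * (B (p.1, p.2.1) ^ 2 + B (p.1 + unitVec p.2.1, p.2.2) ^ 2 +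
          B (p.1 + unitVec p.2.2, p.2.1) ^ 2 + B (p.1, p.2.2) ^ 2) :=
        Finset.sum_le_sum fun p _ => curl_sq_le _ _ _ _
    _ = 4 * ((∑ p ∈ P, B (p.1, p.2.1) ^ 2) + (∑ p ∈ P, B (p.1 + unitVec p.2.1, p.2.2) ^ 2) +
          (∑ p ∈ P, B (p.1 + unitVec p.2.2, p.2.1) ^ 2) + ∑ p ∈ P, B (p.1, p.2.2) ^ 2) := by
        rw [← Finset.mul_sum, Finset.sum_add_distrib, Finset.sum_add_distrib, Finset.sum_add_distrib]
    _ ≤ 4 * ((d : ℝ) * ((d : ℝ) * ∑ b ∈ Ω, B b ^ 2) + (d : ℝ) * ((d : ℝ) * ∑ b ∈ Ω, B b ^ 2) +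
          (d : ℝ) * ((d : ℝ) * ∑ b ∈ Ω, B b ^ 2) + (d : ℝ) * ((d : ℝ) * ∑ b ∈ Ω, B b ^ 2)) := by
        gcongr
    _ = 16 * (d : ℝ) ^ 2 * ∑ b ∈ Ω, B b ^ 2 := by ring

/-- **p. 244: *"The form is bounded from above"*** — on the concrete carrier, with an explicit constant:
`‖B↾_{Λ^c}‖² + L^{−2}‖(Q₁B)↾_{Λ′}‖² + γ₀‖∂₁B‖²_P ≤ (1 + L^{−2} + 16d²γ₀)‖B‖²_Ω` for every `L ≥ 1`, `γ₀ ≥ 0`, finite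
`Λ′ ⊂ Lℤ^d`, finite `Ω`, every plaquette set `P` inside a box `Z × {directions}`, and every `B` vanishing off `Ω`
(no gauge condition needed). [cite: Balaban1984PropagatorsII, (2.120)–(2.122) p.244] -/
theorem form2122_upper (hL : 1 ≤ L) (hΛ : ∀ y ∈ Λ', ∀ i, (L : ℤ) ∣ y i) {γ₀ : ℝ} (hγ : 0 ≤ γ₀)
    (Z : Finset (Fin d → ℤ)) {P : Finset ((Fin d → ℤ) × Fin d × Fin d)}
    (hPZ : P ⊆ Z ×ˢ ((univ : Finset (Fin d)) ×ˢ (univ : Finset (Fin d)))) (B : Cfg d)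
    (hΩ : ∀ b, b ∉ Ω → B b = 0) :
    form2122 L Λ' Ω P γ₀ B ≤ (1 + (L : ℝ) ^ (-(2 : ℝ)) + 16 * (d : ℝ) ^ 2 * γ₀) * normSqOn Ω B := by
  have hL' : (0 : ℝ) < L := by exact_mod_cast hL
  have hN0 : 0 ≤ normSqOn Ω B := sum_nonneg fun _ _ => sq_nonneg _
  have hpow0 : 0 ≤ (L : ℝ) ^ ((d : ℝ) - 2) := Real.rpow_nonneg (Nat.cast_nonneg L) _
  -- ‖B↾_{Λ^c}‖² ≤ ‖B‖²
  have hout : normSqOut L Λ' Ω B ≤ normSqOn Ω B :=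
    Finset.sum_le_sum_of_subset_of_nonneg Finset.sdiff_subset fun _ _ _ => sq_nonneg _
  -- the Q₁-term
  have hq : (L : ℝ) ^ ((d : ℝ) - 2) * q1Of L Λ' B ≤ (L : ℝ) ^ (-(2 : ℝ)) * normSqOn Ω B := by
    have h1 : ((L : ℝ)⁻¹) ^ d = (L : ℝ) ^ (-(d : ℝ)) := by
      rw [inv_pow, ← Real.rpow_natCast, ← Real.rpow_neg (Nat.cast_nonneg L)]
    have hLL : (L : ℝ) ^ ((d : ℝ) - 2) * ((L : ℝ)⁻¹) ^ d = (L : ℝ) ^ (-(2 : ℝ)) := by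
      rw [h1, ← Real.rpow_add hL']
      congr 1
      ring
    calc (L : ℝ) ^ ((d : ℝ) - 2) * q1Of L Λ' B
        ≤ (L : ℝ) ^ ((d : ℝ) - 2) * (((L : ℝ)⁻¹) ^ d * normSqOn Ω B) :=
          mul_le_mul_of_nonneg_left (q1Of_le_of_vanish hL hΛ B Ω hΩ) hpow0
      _ = (L : ℝ) ^ (-(2 : ℝ)) * normSqOn Ω B := by rw [← mul_assoc, hLL]
  -- the plaquette term
  have hD := d1SqOn_le (B := B) Z hPZ hΩ
  unfold form2122
  have : γ₀ * d1SqOn P B ≤ γ₀ * (16 * (d : ℝ) ^ 2 * normSqOn Ω B) := mul_le_mul_of_nonneg_left hD hγ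
  nlinarith

end Upper

end

end Literature.MathematicalPhysics.QuantumFieldTheory.Balaban1983to89.B6Form2122LowerBound
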